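import Summits.BirchSwinnertonDyer.BirchSwinnertonDyer.Theorems.GenusKolyvaginAtTwoShaCardDvdPowAtTwoROneBitDescent
import Summits.BirchSwinnertonDyer.BirchSwinnertonDyer.Theorems.GenusKolyvaginAtTwoEquivariantKolyvaginExactAtTwoSelmerDescentInert
import Summits.BirchSwinnertonDyer.BirchSwinnertonDyer.Theorems.GenusKolyvaginAtTwoEquivariantKolyvaginExactAtTwoSelmerDescentSplit
import Summits.BirchSwinnertonDyer.BirchSwinnertonDyer.Theorems.GenusKolyvaginAtTwoEquivariantKolyvaginExactAtTwoLocalDualityOrder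
import HarnessLib

/-!
# Route `GenusKolyvaginAtTwo`, crux U_T `ShaCardDvdPowAtTwoRT` (stmt-BirchSwinnertonDyer-23658), LINE 19 `rational_pair_descent`,
# stub SANDWICH, brick (B2) «RELAXED INDEX»: `[res⁻¹(Sel^(n)(E_K/K)) : Sel^(n)(E/ℚ)] ∣ ∏_{q ∣ d_K} #E(ℚ_q)[2]`

Seat `bsd-line-gk2-p3` g26 (PROVER seat 3/3, cell `bsd-f1-sign2`), `--supports stmt-BirchSwinnertonDyer-23658` (helper; closes nothing).
THEOREMS ONLY (no definition, no named fact, no `sorry`).  BSD is NOT proved by any of this; neither is U_T nor any stub.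

WHY (LEAD gk2-p1 g19, `Cruxes/ShaCardDvdPowAtTwoRT/Lines/rational-pair-descent-lead-g19.md` §1(d); this seat's memo
`Lines/norm-tate-accounting-gk2p3g26.md` §2–§3).  For `K = ℚ(√c)` quadratic (the Heegner field, `c = d_K ≡ 1 (mod 4)`) and `E = W/ℚ`,
the τ-invariant part of `Sel^(n)(E_K/K)` is `res(S)` with `S := res⁻¹(Sel^(n)(E_K/K)) ≤ H¹(ℚ, E[n])`.  At every place `v ∤ c` the Selmer
condition descends EXACTLY (split `v ∣ N`: `…SelmerDescentSplit`; good `v ∤ c` incl. `v = 2`: `…SelmerDescentInert`; `∞`: silent on `Δ < 0`),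
and along `[K : ℚ] = 2` it descends everywhere UP TO ONE BIT (`…ROneBitDescent`: `2•S ≤ Sel`).  Hence `S/Sel^(n)(E/ℚ)` embeds, by the
localisations at the primes of `c`, into `⊕_{q ∣ c} H¹(ℚ_q, E)[2]`, whose order is `∏_q #E(ℚ_q)[2]` by local Tate duality off `2`
(this lineage's `…LocalDualityOrder.natCard_torsionBy_localH1_eq_of_not_mem`, unconditional).  This is the «norm-index half» of
SANDWICH: `#S ≤ #Sel^(n)(E/ℚ) · 2^{Σ_q dim E(ℚ_q)[2]} = #Sel^(n)(E/ℚ) · 2^(ord₂ c(Wd) − ord₂ c(W))` (`…TamagawaGuard`), i.e.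
`[S_ℚ : Sel] ∣ 2^DEF` on the route's habitat — Kramer's local norm indices `i_q = dim E(ℚ_q)[2]` (1981, Prop. 3) read on the `H¹` side.

* `relaxedSelmer_le` — notation-free: `Sel^(n)(E/ℚ) ≤ S` (`resTorsion_mem_selmerGroup`).
* `mem_selmerGroup_of_mem_relaxed_of_forall_dvd` — **exact descent outside `c`**: `x ∈ S` and `x` Selmer at every `q ∣ c` ⟹ `x ∈ Sel^(n)(E/ℚ)`.
* `two_zsmul_localRestrictionHom_eq_zero_of_mem_relaxed` — for `x ∈ S` the localisation of `x` in `H¹(ℚ_q, E)` is `2`-torsion.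
* **`natCard_relaxed_dvd`**: `#S ∣ #Sel^(n)(E/ℚ) · ∏_{q ∈ D} #(H¹(ℚ_q, E)[2])` for any finite set `D` of places containing those dividing `c`;
  **`natCard_relaxed_dvd_tors`**: the same with `#E(ℚ_q)[2]` (`D` odd places).

References: [Kramer1981] §2 Prop. 3, §4 (13); [McCallumLMS1991] §4 Lemma 4.3; [MilneADT2006] I Thm. 3.2, Lemma 3.3, §6;
[DokchitserDokchitserAnnals2010] Lemma 4.14 (proof).
-/

set_option autoImplicit false
-- `Summit.<P>.<Sub>` repeats `BirchSwinnertonDyer` by the tree's layout convention (D-0017)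
set_option linter.dupNamespace false

noncomputable section

open scoped Classical

namespace Summit.BirchSwinnertonDyer.BirchSwinnertonDyer.Theorems.GenusExact.SelmerDescent

open WeierstrassCurve NumberField IsDedekindDomain Field
open Literature.NumberTheory.EllipticCurves Literature.NumberTheory.GaloisRepresentations
open Summit.BirchSwinnertonDyer.BirchSwinnertonDyer.Theorems.GenusExact.ArchVanishing

variable {K : Type} [Field K] [NumberField K] (W : WeierstrassCurve ℚ) [W.IsElliptic]

omit [W.IsElliptic] in
/-- `Sel^(n)(E/ℚ) ≤ S = res⁻¹(Sel^(n)(E_K/K))`: restriction preserves the Selmer condition.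
[cite: DokchitserDokchitserAnnals2010, Lemma 4.14 (proof)] -/
theorem relaxedSelmer_le (n : ℤ) :
    selmerGroup W n ≤ (selmerGroup (W.baseChange K) n).comap (resTorsion W K n) :=
  fun _ hx ↦ AddSubgroup.mem_comap.mpr (resTorsion_mem_selmerGroup W K n hx)

/-- **Exact descent outside `c`.**  Let `K = ℚ(θ)`, `θ² = c = 1 + 4d ∈ ℤ` (`θ ∉ ℚ`), `E = W/ℚ` elliptic with `Δ < 0`, and suppose `c` is a
square in `ℚ_v` at every place `v` of bad reduction (Heegner: the bad primes split in `K`).  If `x ∈ H¹(ℚ, E[n])` restricts into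
`Sel^(n)(E_K/K)` and `x` satisfies the local Selmer condition of `E` at every place `q` with `q ∣ c`, then `x ∈ Sel^(n)(E/ℚ)`.
[cite: McCallumLMS1991, §4 Lemma 4.3] [cite: MilneADT2006, I Prop. 3.8] -/
theorem mem_selmerGroup_of_mem_relaxed_of_forall_dvd (h2 : Module.finrank ℚ K = 2) {θ : K}
    (hθ : θ ∉ (algebraMap ℚ K).range) {c d : ℤ} (hcd : c = 1 + 4 * d) (hc : θ ^ 2 = algebraMap ℚ K c) (hΔ : W.Δ < 0)
    (hbad : ∀ v : HeightOneSpectrum (𝓞 ℚ), ¬ W.HasGoodReductionAt v →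
      ∃ s : v.adicCompletion ℚ, s ^ 2 = algebraMap ℚ (v.adicCompletion ℚ) c)
    (n : ℤ) {x : galH1Torsion W n} (hx : resTorsion W K n x ∈ selmerGroup (W.baseChange K) n)
    (hD : ∀ q : HeightOneSpectrum (𝓞 ℚ), ((c : ℤ) : 𝓞 ℚ) ∈ q.asIdeal → x ∈ selmerLocalKer W (q.adicCompletion ℚ) n) :
    x ∈ selmerGroup W n := by
  rw [mem_selmerGroup_iff] at hx ⊢
  refine ⟨fun v ↦ ?_, fun w ↦ mem_selmerLocalKer_infinitePlace_of_Δ_neg W w hΔ n _⟩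
  by_cases hcv : ((c : ℤ) : 𝓞 ℚ) ∈ v.asIdeal
  · exact hD v hcv
  obtain ⟨w, hw⟩ := exists_liesOver K v
  by_cases hgood : W.HasGoodReductionAt v
  · exact mem_selmerLocalKer_of_resTorsion_mem_quadratic_of_one_add_four_mul W h2 hθ hcd hc n v w hgood hcv (hx.1 w)
  · exact mem_selmerLocalKer_of_resTorsion_mem_quadratic_of_sq W h2 hθ hc n v w (hbad v hgood) (hx.1 w)

/-- For `x ∈ S = res⁻¹(Sel^(n)(E_K/K))` (`[K : ℚ] = 2`, `Δ < 0`) the localisation of `x` in `H¹(ℚ_q, E)` is `2`-torsion at every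
finite place `q`: `2x ∈ Sel^(n)(E/ℚ)` (one-bit descent) dies in `H¹(ℚ_q, E)`. [cite: McCallumLMS1991, §4 Lemma 4.3]
[cite: DokchitserDokchitserAnnals2010, Lemma 4.14 (proof)] -/
theorem two_zsmul_localRestrictionHom_eq_zero_of_mem_relaxed (h2 : Module.finrank ℚ K = 2) (hΔ : W.Δ < 0) (n : ℤ)
    {x : galH1Torsion W n} (hx : resTorsion W K n x ∈ selmerGroup (W.baseChange K) n) (q : HeightOneSpectrum (𝓞 ℚ)) :
    (2 : ℤ) • W.localRestrictionHom (q.adicCompletion ℚ) (torsionH1ToH1 W n x) = 0 := by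
  have h2x : (2 : ℤ) • x ∈ selmerGroup W n := two_zsmul_mem_selmerGroup_of_resTorsion_mem W h2 hΔ n hx
  rw [mem_selmerGroup_iff] at h2x
  have hq := h2x.1 q
  rw [mem_selmerLocalKer_iff_torsionH1ToH1_mem, mem_localRestrictionKer_iff, map_zsmul, map_zsmul] at hq
  exact hq

/-- **RELAXED INDEX (brick (B2) of SANDWICH), `H¹`-form.**  With the hypotheses of `mem_selmerGroup_of_mem_relaxed_of_forall_dvd` and a
finite set `D` of finite places containing every place dividing `c`:
`#S ∣ #Sel^(n)(E/ℚ) · ∏_{q ∈ D} #(H¹(ℚ_q, E)[2])`, `S = res⁻¹(Sel^(n)(E_K/K))` — the map `x ↦ (loc_q x)_{q ∈ D}` sends `S` into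
`⊕_{q ∈ D} H¹(ℚ_q, E)[2]` with kernel exactly `Sel^(n)(E/ℚ)`. (All cardinalities `Nat.card`; if some factor were infinite the statement is
`∣ 0`.) [cite: Kramer1981, §2 Prop. 3 and §4 (13)] [cite: MilneADT2006, I §6] -/
theorem natCard_relaxed_dvd (h2 : Module.finrank ℚ K = 2) {θ : K}
    (hθ : θ ∉ (algebraMap ℚ K).range) {c d : ℤ} (hcd : c = 1 + 4 * d) (hc : θ ^ 2 = algebraMap ℚ K c) (hΔ : W.Δ < 0)
    (hbad : ∀ v : HeightOneSpectrum (𝓞 ℚ), ¬ W.HasGoodReductionAt v →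
      ∃ s : v.adicCompletion ℚ, s ^ 2 = algebraMap ℚ (v.adicCompletion ℚ) c)
    (n : ℤ) (D : Finset (HeightOneSpectrum (𝓞 ℚ))) (hD : ∀ q : HeightOneSpectrum (𝓞 ℚ), ((c : ℤ) : 𝓞 ℚ) ∈ q.asIdeal → q ∈ D) :
    Nat.card ((selmerGroup (W.baseChange K) n).comap (resTorsion W K n)) ∣
      Nat.card (selmerGroup W n) *
        ∏ q ∈ D, Nat.card (AddSubgroup.torsionBy (W.localH1 (q.adicCompletion ℚ)) (2 : ℤ)) := by
  set S := (selmerGroup (W.baseChange K) n).comap (resTorsion W K n) with hS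
  -- the localisation map `S → Π_{q ∈ D} H¹(ℚ_q, E)[2]`
  have hmem2 : ∀ (x : S) (q : D), W.localRestrictionHom ((q : HeightOneSpectrum (𝓞 ℚ)).adicCompletion ℚ)
      (torsionH1ToH1 W n (x : galH1Torsion W n)) ∈
        AddSubgroup.torsionBy (W.localH1 ((q : HeightOneSpectrum (𝓞 ℚ)).adicCompletion ℚ)) (2 : ℤ) := by
    intro x q
    exact two_zsmul_localRestrictionHom_eq_zero_of_mem_relaxed W h2 hΔ n (AddSubgroup.mem_comap.mp x.2) _
  let Φ : S →+ ((q : D) → AddSubgroup.torsionBy (W.localH1 ((q : HeightOneSpectrum (𝓞 ℚ)).adicCompletion ℚ)) (2 : ℤ)) :=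
    { toFun := fun x q => ⟨_, hmem2 x q⟩
      map_zero' := by
        funext q
        ext
        simp
      map_add' := fun x y => by
        funext q
        ext
        simp }
  -- its kernel is `Sel^(n)(E/ℚ)` (as a subgroup of `S`)
  have hker : Φ.ker = (selmerGroup W n).addSubgroupOf S := by
    ext x
    rw [AddMonoidHom.mem_ker, AddSubgroup.mem_addSubgroupOf]
    constructor
    · intro hx0
      refine mem_selmerGroup_of_mem_relaxed_of_forall_dvd W h2 hθ hcd hc hΔ hbad n (AddSubgroup.mem_comap.mp x.2) fun q hq ↦ ?_
      rw [mem_selmerLocalKer_iff_torsionH1ToH1_mem, mem_localRestrictionKer_iff]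
      have := congrArg (fun f => ((f ⟨q, hD q hq⟩ : AddSubgroup.torsionBy _ (2 : ℤ)) : W.localH1 (q.adicCompletion ℚ))) hx0
      simpa [Φ] using this
    · intro hxSel
      funext q
      ext
      have hxSel' := hxSel
      rw [mem_selmerGroup_iff] at hxSel'
      have hq := hxSel'.1 (q : HeightOneSpectrum (𝓞 ℚ))
      rw [mem_selmerLocalKer_iff_torsionH1ToH1_mem, mem_localRestrictionKer_iff] at hq
      simpa [Φ] using hq
  -- count: `#S = #(S ⧸ ker Φ) · #ker Φ`, `#(S ⧸ ker Φ) = #range Φ ∣ #Π`, `#ker Φ = #Sel`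
  have hSel_le : selmerGroup W n ≤ S := relaxedSelmer_le W n
  have hkercard : Nat.card Φ.ker = Nat.card (selmerGroup W n) := by
    rw [hker]
    exact Nat.card_congr (AddSubgroup.addSubgroupOfEquivOfLe hSel_le).toEquiv
  have hrange : Nat.card (S ⧸ Φ.ker) = Nat.card Φ.range :=
    Nat.card_congr (QuotientAddGroup.quotientKerEquivRange Φ).toEquiv
  have hdvd : Nat.card Φ.range ∣ Nat.card ((q : D) →
      AddSubgroup.torsionBy (W.localH1 ((q : HeightOneSpectrum (𝓞 ℚ)).adicCompletion ℚ)) (2 : ℤ)) :=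
    AddSubgroup.card_addSubgroup_dvd_card Φ.range
  rw [AddSubgroup.card_eq_card_quotient_mul_card_addSubgroup Φ.ker, hkercard, hrange, mul_comm]
  refine Nat.mul_dvd_mul_left _ (hdvd.trans ?_)
  rw [Nat.card_pi, ← Finset.prod_coe_sort D]

/-- **RELAXED INDEX, points form**: with `D` a finite set of ODD finite places containing those dividing `c`,
`#S ∣ #Sel^(n)(E/ℚ) · ∏_{q ∈ D} #E(ℚ_q)[2]` — local Tate duality off `2` (`#H¹(ℚ_q, E)[2] = #E(ℚ_q)[2]`, this lineage's
`LocalDualityOrder.natCard_torsionBy_localH1_eq_of_not_mem`).  On the route's habitat (`c = d_K`, `D` = the primes of `d_K`):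
`[S_ℚ : Sel] ∣ 2^(Σ_q dim E(ℚ_q)[2]) = 2^DEF·4^(#split primes)` — the «norm-index half» of SANDWICH (LEAD g19 memo §1(d)).
[cite: Kramer1981, §2 Prop. 3 and §4 (13)] [cite: MilneADT2006, I Thm. 3.2 and Lemma 3.3] -/
theorem natCard_relaxed_dvd_tors (h2 : Module.finrank ℚ K = 2) {θ : K}
    (hθ : θ ∉ (algebraMap ℚ K).range) {c d : ℤ} (hcd : c = 1 + 4 * d) (hc : θ ^ 2 = algebraMap ℚ K c) (hΔ : W.Δ < 0)
    (hbad : ∀ v : HeightOneSpectrum (𝓞 ℚ), ¬ W.HasGoodReductionAt v →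
      ∃ s : v.adicCompletion ℚ, s ^ 2 = algebraMap ℚ (v.adicCompletion ℚ) c)
    (n : ℤ) (D : Finset (HeightOneSpectrum (𝓞 ℚ))) (hD : ∀ q : HeightOneSpectrum (𝓞 ℚ), ((c : ℤ) : 𝓞 ℚ) ∈ q.asIdeal → q ∈ D)
    (hD2 : ∀ q ∈ D, (2 : 𝓞 ℚ) ∉ q.asIdeal) :
    Nat.card ((selmerGroup (W.baseChange K) n).comap (resTorsion W K n)) ∣
      Nat.card (selmerGroup W n) *
        ∏ q ∈ D, Nat.card (nsmulAddMonoidHom (2 ^ 1) :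
          (W.baseChange (q.adicCompletion ℚ)).toAffine.Point →+ _).ker := by
  haveI : Fact (Nat.Prime 2) := ⟨Nat.prime_two⟩
  have h := natCard_relaxed_dvd W h2 hθ hcd hc hΔ hbad n D hD
  refine h.trans (dvd_of_eq ?_)
  congr 1
  refine Finset.prod_congr rfl fun q hq ↦ ?_
  have hloc := LocalDualityOrder.natCard_torsionBy_localH1_eq_of_not_mem q W (p := 2) (k := 1) one_ne_zero
    (by exact_mod_cast hD2 q hq)
  -- `galoisCohomology (W.localGaloisModule ℚ_q) 1 = W.localH1 ℚ_q` (definitional) and `((2^1 : ℕ) : ℤ) = 2`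
  change Nat.card (AddSubgroup.torsionBy (W.localH1 (q.adicCompletion ℚ)) ((2 ^ 1 : ℕ) : ℤ)) = _ at hloc
  rw [← hloc]
  norm_num

end Summit.BirchSwinnertonDyer.BirchSwinnertonDyer.Theorems.GenusExact.SelmerDescent

end
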